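/-
Copyright (c) 2026 the pub-hodgecm-mathlib formalisation cell (harness21).  Prover seat hodgecm-mathlib-K2E3-p06 (g4), Track B «K2-LIT», engine E3, unit U4 «Keys»; deal (D61)
LINE LEAD of the open leaf (U4f-χ₁-ram-one), design D-I v2 (`K2/K2E3-p06/g4/DESIGN-M2-v2-DepthZero.K2E3-p06-g4.md`, observation (O1)), brick (V2b) = Z1-generic; 2026-09-04.
KERNEL module: THEOREMS ONLY (no definition, no named fact, no `sorry`, no instance, no notation).
-/
import Summits.HodgeConjecture.HodgeConjecture.Theorems.K2E3TypeVectorOfSubrep   -- ★ (V2) (this seat): `sum_twisted_eigenvector`, `sum_twisted_mem`, `apply_eq_mul_one`, `toFun_sum_apply`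
import HarnessLib

/-!
# K2 ∕ E3 «EllipticInputs», unit U4 «Keys» — (U4f-χ₁-ram-one) brick (V2b): THE TYPE VECTOR FOR A COMPACT GROUP FACTORED AS `(B ∩ H)·C` WITH `C` FIXING THE SECTION
# (the Iwahori∕Roche type group `J = (J ∩ P)·N̄_c` after torus dilation)   [Roche1998 §3; BernsteinZelevinsky1976 §2.3; Casselman1995 §1.4, §3.3; MoyPrasad1996 §3]

Cell hodgecm-mathlib (D-0151), FLOOR 0, Track B «K2-LIT», engine E3, crux item H413 = stmt-HodgeConjecture-24833 (route `HCCMUnconditional`, no route verbs); target BY NAME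
the OPEN leaf `…K2E3EllipticInputs.U4Keys.sig_K2E3KeysThmTwoContractingRamifiedCharOne` (U4Keys ED. 7), design D-I v2, plan-of-record step Z1 (generic part).  Author K2E3-p06 (g4),
line lead (D61).  `--supports stmt-HodgeConjecture-24833 --as helper`; THEOREMS ONLY.  NOT THE PAYER.

THE POINT (design v2 (O1), K2E3-r01 (g3)'s (R-D)).  ★ (V2) `exists_typeVector_of_mem` averages over a compact `B ≤ H` (inside the inducing subgroup), where the value at `1` is
automatically preserved.  The type group of a principal-series character is NOT inside the Borel: `J = N̄_c · T(𝒪) · N(𝒪)` (Iwahori factorisation; at depth zero `J = I`).  The extra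
factor `N̄_c` is harmless AS SOON AS IT FIXES THE SECTION (which torus DILATION arranges: `Stab(t·f) = Ad(t)·Stab(f) ⊇ N̄_c` for `t` EXPANDING `N̄`, i.e. contracting `N`): if every `b ∈ B` factors as
`b = p·c` with `p ∈ B ∩ H` and `c ∈ C`, `C` a subgroup fixing `f`, then for ANY `θ : G → ℂ` multiplicative on `B`, equal to `τ` on `B ∩ H` and to `1` on `B ∩ C` (the character `χ̃` of
the type), the `θ`-twisted average `f′ = Σ_r θ(r)⁻¹ r·f` over a transversal of `B ∕ (B ∩ Stab f)` lies in `V`, is a `(B, θ)`-eigenvector (★ (V2) §1), and has **`f′(1) = |R|·f(1) ≠ 0`**: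
each summand contributes `θ(pc)⁻¹ f(pc) = τ(p)⁻¹ · τ(p) f(1)` (`f(pc) = (c·f)(p) = f(p) = τ(p)f(1)`), and `θ = 1` on `B ∩ Stab f` is AUTOMATIC (`s = pc` fixes `f` ⇒ `p = s c⁻¹` fixes `f` ⇒
`τ(p) f(1) = f(p) = f(1)` ⇒ `τ(p) = 1`).  So `V ∩ i(χ)^{(J, χ̃)} ≠ 0` for every `G`-subrepresentation `V ∋ f` with `f(1) ≠ 0` — the TYPE property for free, inside design D-I.
* §1 **`exists_typeVector_of_mem_of_factored`** — the statement above (generic smooth induction from a one-dimensional `τ`; `B` compact, `C` any subgroup with `B ⊆ (B ∩ H)·C` and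
  `C ∩ B ⊆ Stab f`).  ★ (V2) `exists_typeVector_of_mem` is the case `C = ⊥`.
HONEST LABEL: HC_CM is proved only modulo the 7 printed citations (2 remaining named inputs: hLiu418 = stmt-HodgeConjecture-24832, h413 = stmt-HodgeConjecture-24833)
until rung 0 closes; count-neutral — this file does NOT pay the leaf; no printed citation is discharged.

## References
* [Roche1998] A. Roche, *Types and Hecke algebras for principal series representations of split reductive p-adic groups*, Ann. Sci. ÉNS (4) 31 (1998), §3 (the pair `(J_χ, χ̃)`,
  Iwahori factorisation `J = (J ∩ N̄)(J ∩ T)(J ∩ N)`).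
* [BernsteinZelevinsky1976] I. N. Bernstein, A. V. Zelevinsky, Russian Math. Surveys 31:3 (1976), §2.3 (idempotents as finite averages).
* [Casselman1995] W. Casselman, *Introduction to the theory of admissible representations of `p`-adic reductive groups* (1995), §1.4 (Iwahori factorisation), §3.3.
* [MoyPrasad1996] A. Moy, G. Prasad, *Jacquet functors and unrefined minimal K-types*, Comment. Math. Helv. 71 (1996), §3 (depth-zero types `(I, χ̃)`).
-/

set_option autoImplicit false
-- the mandated namespace has the single-problem summit's repeated segment (`HodgeConjecture.HodgeConjecture`)
set_option linter.dupNamespace false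

noncomputable section

open Literature.NumberTheory.Automorphic

namespace Summit.HodgeConjecture.HodgeConjecture.Cruxes.H413.K2E3TypeVectorOfSubrepFactored

open Summit.HodgeConjecture.HodgeConjecture.Cruxes.H413 Summit.HodgeConjecture.HodgeConjecture.Cruxes.H413.K2E3TypeVectorOfSubrep

variable {G : Type*} [Group G] [TopologicalSpace G] [IsTopologicalGroup G] (H : Subgroup G) (τ : Representation ℂ ↥H ℂ)

/-! ## §1 The type vector for `B ⊆ (B ∩ H)·C`, `C ∩ B` fixing the section -/

/-- **THE TYPE VECTOR OF A SUBREPRESENTATION OF `Ind_H^G τ` FOR A FACTORED COMPACT GROUP.**  `τ` one-dimensional; `B` a compact subgroup of `G`; `C` a subgroup with `B ⊆ (B ∩ H)·C`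
(`hBC`: every `b ∈ B` is `p·c`, `p ∈ H ∩ B`, `c ∈ C`); `V` a `G`-stable submodule, `f ∈ V` with `f(1) ≠ 0` FIXED BY `C ∩ B` (`hCf`); `θ : G → ℂ` multiplicative on `B`, `= τ(p)` for
`p ∈ B ∩ H`, `= 1` on `C ∩ B`.  Then **`∃ f′ ∈ V`, `f′(1) ≠ 0`, `b·f′ = θ(b) • f′` for all `b ∈ B`** — the `θ`-twisted average over a transversal of `B ∕ (B ∩ Stab f)` (★ (V2)
`sum_twisted_eigenvector`): `θ = 1` on `B ∩ Stab f` is automatic (`s = pc` and `c` fix `f` ⇒ `p` fixes `f` ⇒ `τ(p) = 1` as `f(1) ≠ 0`), `θ ≠ 0` on `B` (`τ(p)` is invertible), and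
`f′(1) = |R|·f(1)` (`f(pc) = f(p) = τ(p) f(1)`).  ★ (V2) `exists_typeVector_of_mem` is the case `C = ⊥`.
[cite: Roche1998, §3] [cite: BernsteinZelevinsky1976, §2.3] [cite: Casselman1995, §1.4, §3.3] [cite: MoyPrasad1996, §3] -/
theorem exists_typeVector_of_mem_of_factored (B C : Subgroup G) (hB : IsCompact (B : Set G))
    (hBC : ∀ b ∈ B, ∃ p ∈ B, p ∈ H ∧ ∃ c ∈ C, b = p * c)
    (θ : G → ℂ) (hθmul : ∀ x ∈ B, ∀ y ∈ B, θ (x * y) = θ x * θ y)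
    (hθH : ∀ p (hp : p ∈ H), p ∈ B → θ p = τ (⟨p, hp⟩ : ↥H) 1) (hθC : ∀ c ∈ C, c ∈ B → θ c = 1)
    (V : Subrepresentation (Representation.smoothIndRep H τ)) (f : Representation.SmoothInd H τ) (hfV : f ∈ V) (hf1 : f.toFun 1 ≠ 0)
    (hCf : ∀ c ∈ C, c ∈ B → Representation.smoothIndRep H τ c f = f) :
    ∃ f' : Representation.SmoothInd H τ, f' ∈ V ∧ f'.toFun 1 ≠ 0 ∧
      ∀ b ∈ B, Representation.smoothIndRep H τ b f' = θ b • f' := by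
  classical
  -- the open stabiliser and a finite transversal of `B ∕ (B ∩ Stab f)`
  have hsm : (Representation.smoothIndRep H τ).IsSmoothVector f := Representation.isSmooth_smoothInd H τ f
  obtain ⟨R, hR⟩ := exists_isLeftTransversal (B := B) (T := (Representation.smoothIndRep H τ).stabilizerSubgroup f) hB hsm
  have hTv : ∀ t ∈ (Representation.smoothIndRep H τ).stabilizerSubgroup f, Representation.smoothIndRep H τ t f = f :=
    fun t ht => ((Representation.smoothIndRep H τ).mem_stabilizerSubgroup f t).1 ht
  -- `c ∈ C ∩ B` and the `H`-part of `b = p c`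
  have hcB : ∀ {b p c : G}, b ∈ B → p ∈ B → b = p * c → c ∈ B := by
    intro b p c hb hp hbc
    have : c = p⁻¹ * b := by rw [hbc, inv_mul_cancel_left]
    rw [this]; exact B.mul_mem (B.inv_mem hp) hb
  -- the value of `f` at `p ∈ H`: `f(p) = τ(p) f(1)`
  have hfH : ∀ p (hp : p ∈ H), f.toFun p = τ (⟨p, hp⟩ : ↥H) 1 * f.toFun 1 := by
    intro p hp
    have h := f.toFun_subgroup_mul (⟨p, hp⟩ : ↥H) 1
    rw [mul_one, apply_eq_mul_one] at h
    exact h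
  -- `θ ≠ 0` on `B`
  have hθ0 : ∀ x ∈ B, θ x ≠ 0 := by
    intro x hx
    obtain ⟨p, hpB, hpH, c, hcC, hxe⟩ := hBC x hx
    have hcB' : c ∈ B := hcB hx hpB hxe
    rw [hxe, hθmul p hpB c hcB', hθH p hpH hpB, hθC c hcC hcB', mul_one]
    intro h0
    have hinv : τ ((⟨p, hpH⟩ : ↥H)⁻¹) (τ (⟨p, hpH⟩ : ↥H) 1) = 1 := by
      rw [← Module.End.mul_apply, ← map_mul, inv_mul_cancel, MonoidHom.map_one, Module.End.one_apply]
    rw [h0, map_zero] at hinv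
    exact zero_ne_one hinv
  -- `θ = 1` on `B ∩ Stab f` (automatic from `f(1) ≠ 0`)
  have hθS : ∀ s ∈ B, s ∈ (Representation.smoothIndRep H τ).stabilizerSubgroup f → θ s = 1 := by
    intro s hsB hs
    obtain ⟨p, hpB, hpH, c, hcC, hse⟩ := hBC s hsB
    have hcB' : c ∈ B := hcB hsB hpB hse
    -- `p = s c⁻¹` fixes `f`
    have hpfix : Representation.smoothIndRep H τ p f = f := by
      have hp : p = s * c⁻¹ := by rw [hse, mul_inv_cancel_right]
      have hcinv : Representation.smoothIndRep H τ c⁻¹ f = f := by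
        have h := hCf c hcC hcB'
        have h2 := congrArg (Representation.smoothIndRep H τ c⁻¹) h
        rw [← Module.End.mul_apply, ← map_mul, inv_mul_cancel, map_one, Module.End.one_apply] at h2
        exact h2.symm
      rw [hp, map_mul, Module.End.mul_apply, hcinv, hTv s hs]
    have hval := congrArg (fun φ : Representation.SmoothInd H τ => φ.toFun 1) hpfix
    simp only [Representation.toFun_smoothIndRep_apply, one_mul] at hval
    rw [hfH p hpH] at hval
    have hτ : τ (⟨p, hpH⟩ : ↥H) 1 = 1 := by
      have := mul_right_cancel₀ hf1 (hval.trans (one_mul _).symm)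
      exact this
    rw [hse, hθmul p hpB c hcB', hθH p hpH hpB, hθC c hcC hcB', hτ, one_mul]
  refine ⟨∑ r ∈ R, (θ r)⁻¹ • Representation.smoothIndRep H τ r f, sum_twisted_mem (Representation.smoothIndRep H τ) V hfV θ R, ?_,
    fun b hb => sum_twisted_eigenvector (Representation.smoothIndRep H τ) hR hTv θ hθmul hθ0 hθS hb⟩
  -- `f′(1) = |R| · f(1)`
  have hval : ∀ r ∈ R, ((θ r)⁻¹ • Representation.smoothIndRep H τ r f).toFun 1 = f.toFun 1 := by
    intro r hr
    have hrB : r ∈ B := hR.mem_of_mem r hr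
    obtain ⟨p, hpB, hpH, c, hcC, hre⟩ := hBC r hrB
    have hcB' : c ∈ B := hcB hrB hpB hre
    rw [Representation.SmoothInd.toFun_smul, Pi.smul_apply, Representation.toFun_smoothIndRep_apply, one_mul, smul_eq_mul,
      hre, hθmul p hpB c hcB', hθH p hpH hpB, hθC c hcC hcB', mul_one]
    -- `f(p c) = (c·f)(p) = f(p) = τ(p) f(1)`
    have hpc : f.toFun (p * c) = f.toFun p := by
      have h := congrArg (fun φ : Representation.SmoothInd H τ => φ.toFun p) (hCf c hcC hcB')
      simp only [Representation.toFun_smoothIndRep_apply] at h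
      exact h
    rw [hpc, hfH p hpH, ← mul_assoc, inv_mul_cancel₀ ?_, one_mul]
    intro h0
    exact hθ0 r hrB (by rw [hre, hθmul p hpB c hcB', hθH p hpH hpB, hθC c hcC hcB', h0, zero_mul])
  rw [toFun_sum_apply H τ R (fun r => (θ r)⁻¹ • Representation.smoothIndRep H τ r f) 1, Finset.sum_congr rfl hval, Finset.sum_const, nsmul_eq_mul]
  exact mul_ne_zero (Nat.cast_ne_zero.2 (Finset.card_pos.2 hR.nonempty).ne') hf1

end Summit.HodgeConjecture.HodgeConjecture.Cruxes.H413.K2E3TypeVectorOfSubrepFactored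

end
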